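import Summits.AnomalousDissipation.AnomalousDissipation.Theorems.SawtoothPulseCascadeLipAgmonShearGrowth

/-!
# Shear-nilpotent growth over one half pulse: the unipotent slot summary
(route `AnomalousDissipation/SawtoothPulseCascade`, line `lip-agmon` of the crux ApproxSol58 =
stmt-AnomalousDissipation-19688; lead g4, module E-abstract, part 2)

Sequel of `…LipAgmonShearGrowth`. Integrating the five triangular bounds over one half pulse `[a, b]`
of a shear drift (cumulative strain `Γ = ∫ₐᵇ α`, curvature budget `Β = ∫ₐᵇ β`, source budgets
`Σ• = ∫ₐᵇ σ•`) gives EXACTLY the unipotent matrices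
`(Wₖ, Wₖ') ↦ (Wₖ, Wₖ' + Γ Wₖ)` (`slot_level_one`) and
`(Vₖₖ, Vₖₖ', Vₖ'ₖ') ↦ (Vₖₖ, Vₖₖ' + Γ Vₖₖ, Vₖ'ₖ' + 2Γ Vₖₖ' + Γ² Vₖₖ)` plus `Β Wₖ` (`slot_level_two`),
all entries shifted by the source budgets; the `Γ²` (not `2Γ²`) comes from the time-ordered double
strain integral `∫ₐᵗ α(τ)A(τ)dτ = A(t)²/2` (`integral_mul_cumulative_eq`). Over a full phase (an H half
pulse then a V half pulse, `Γ = γ` each) the level-1 sizes grow by at most `(1 + γ)²` and the level-2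
sizes by at most `(1 + γ + γ²)²` on top of the source production — the transport factors of the line
`lip-agmon` (`4(1 + γ + γ²)² < (γ² − 3)³` on `[5, 8]`).
-/

set_option linter.dupNamespace false

noncomputable section

namespace Summit.AnomalousDissipation.AnomalousDissipation.Theorems.SawtoothPulseCascade.LipAgmon

open Set MeasureTheory intervalIntegral
open scoped InnerProductSpace ContDiff
open Literature.Analysis Literature.Analysis.FunctionSpaces Literature.Analysis.FluidPDE
open Literature.Analysis.FunctionSpaces.Torus

/-! ## §4 Time-integral bookkeeping on a slot -/

section Time

/-- `∫ₐᵗ f ≤ ∫ₐᵇ f` for `t ∈ [a, b]` and `f ≥ 0` on `[a, b]` (continuous `f`). [folklore] -/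
theorem integral_le_integral_right {f : ℝ → ℝ} (hf : Continuous f) {a b t : ℝ} (ht : t ∈ Icc a b)
    (h0 : ∀ τ ∈ Icc a b, 0 ≤ f τ) : ∫ τ in a..t, f τ ≤ ∫ τ in a..b, f τ := by
  have hadd : (∫ τ in a..t, f τ) + ∫ τ in t..b, f τ = ∫ τ in a..b, f τ :=
    intervalIntegral.integral_add_adjacent_intervals (hf.intervalIntegrable a t) (hf.intervalIntegrable t b)
  have hnn : 0 ≤ ∫ τ in t..b, f τ :=
    intervalIntegral.integral_nonneg ht.2 fun τ hτ => h0 τ ⟨ht.1.trans hτ.1, hτ.2⟩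
  linarith

/-- `0 ≤ ∫ₐᵗ f` for `t ∈ [a, b]` and `f ≥ 0` on `[a, b]`. [folklore] -/
theorem integral_nonneg_of_mem_Icc {f : ℝ → ℝ} {a b t : ℝ} (ht : t ∈ Icc a b)
    (h0 : ∀ τ ∈ Icc a b, 0 ≤ f τ) : 0 ≤ ∫ τ in a..t, f τ :=
  intervalIntegral.integral_nonneg ht.1 fun τ hτ => h0 τ ⟨hτ.1, hτ.2.trans ht.2⟩

/-- **The time-ordered double strain integral**: `∫ₐᵗ α(τ) A(τ) dτ = A(t)²/2` for the cumulative
strain `A(τ) = ∫ₐ^τ α` of a continuous rate `α` (`(A²/2)' = αA`). This identity is what makes the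
second cross derivative pick up exactly `Γ²` (not `2Γ²`) per half pulse. [folklore] -/
theorem integral_mul_cumulative_eq {α : ℝ → ℝ} (hα : Continuous α) (a t : ℝ) :
    ∫ τ in a..t, α τ * (∫ σ in a..τ, α σ) = (∫ σ in a..t, α σ) ^ 2 / 2 := by
  have hA : ∀ τ, HasDerivAt (fun τ => ∫ σ in a..τ, α σ) (α τ) τ := fun τ =>
    (hα.integral_hasStrictDerivAt a τ).hasDerivAt
  have hF : ∀ τ ∈ uIcc a t, HasDerivAt (fun τ => (∫ σ in a..τ, α σ) * (∫ σ in a..τ, α σ) / 2)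
      (α τ * ∫ σ in a..τ, α σ) τ := by
    intro τ _
    refine (((hA τ).fun_mul (hA τ)).div_const 2).congr_deriv ?_
    ring
  have hcont : Continuous fun τ => α τ * ∫ σ in a..τ, α σ :=
    hα.mul (intervalIntegral.continuous_primitive (fun _ _ => hα.intervalIntegrable _ _) a)
  rw [intervalIntegral.integral_eq_sub_of_hasDerivAt hF (hcont.intervalIntegrable a t)]
  simp [sq]

/-- `∫ₐᵗ α(τ) A(τ) dτ ≤ Γ²/2` with `Γ = ∫ₐᵇ α`, for `t ∈ [a, b]`, `α ≥ 0` on `[a, b]`. [folklore] -/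
theorem integral_mul_cumulative_le {α : ℝ → ℝ} (hα : Continuous α) {a b t : ℝ} (ht : t ∈ Icc a b)
    (h0 : ∀ τ ∈ Icc a b, 0 ≤ α τ) :
    ∫ τ in a..t, α τ * (∫ σ in a..τ, α σ) ≤ (∫ σ in a..b, α σ) ^ 2 / 2 := by
  rw [integral_mul_cumulative_eq hα a t]
  have h1 : ∫ σ in a..t, α σ ≤ ∫ σ in a..b, α σ := integral_le_integral_right hα ht h0
  have h2 : 0 ≤ ∫ σ in a..t, α σ := integral_nonneg_of_mem_Icc ht h0
  have h3 : (∫ σ in a..t, α σ) ^ 2 ≤ (∫ σ in a..b, α σ) ^ 2 := pow_le_pow_left₀ h2 h1 2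
  linarith

end Time


/-! ## §5 The slot summary: unipotent growth over one half pulse -/

section Slot

variable {d : Type*} [Fintype d] [DecidableEq d]
variable {a b κ : ℝ} {u : ℝ → UnitAddTorus d → EuclideanSpace ℝ d} {s θ : ℝ → UnitAddTorus d → ℝ}
variable {k k' : d} {α β : ℝ → ℝ}

/-- `∫ₐᵗ (σ + αB) ≤ ∫ₐᵇ σ + B ∫ₐᵇ α` for `t ∈ [a, b]`, `σ, α ≥ 0` on `[a, b]`, `B ≥ 0`. [folklore] -/
theorem integral_add_mul_const_le {σ α : ℝ → ℝ} (hσ : Continuous σ) (hα : Continuous α) {a b t : ℝ}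
    (ht : t ∈ Icc a b) (hσ0 : ∀ τ ∈ Icc a b, 0 ≤ σ τ) (hα0 : ∀ τ ∈ Icc a b, 0 ≤ α τ) {B : ℝ}
    (hB : 0 ≤ B) :
    ∫ τ in a..t, (σ τ + α τ * B) ≤ (∫ τ in a..b, σ τ) + B * ∫ τ in a..b, α τ := by
  have hc : Continuous fun τ => α τ * B := hα.mul continuous_const
  rw [intervalIntegral.integral_add (hσ.intervalIntegrable a t) (hc.intervalIntegrable a t),
    intervalIntegral.integral_mul_const]
  have h1 := integral_le_integral_right hσ ht hσ0
  have h2 := integral_le_integral_right hα ht hα0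
  nlinarith

/-- **Slot summary, level 1.** Over one half pulse `[a, b]` of a shear drift (`∂ₖu = 0`,
`|⟪∂ₖ'u, w⟫| ≤ α|wₖ|`, cumulative strain `Γ = ∫ₐᵇ α`), with source-derivative budgets
`Σₖ = ∫ₐᵇ σₖ ≥ ∫‖∂ₖs‖₂`, `Σₖ' = ∫ₐᵇ σₖ'`: for all `t ∈ [a, b]`,
`‖∂ₖθ(t)‖₂ ≤ ‖∂ₖθ(a)‖₂ + Σₖ` and `‖∂ₖ'θ(t)‖₂ ≤ ‖∂ₖ'θ(a)‖₂ + Σₖ' + Γ(‖∂ₖθ(a)‖₂ + Σₖ)` — the unipotent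
map `(Wₖ, Wₖ') ↦ (Wₖ, Wₖ' + ΓWₖ)`, uniformly in `κ ≥ 0`.
[cite: MajdaBertozzi2002, §3.2 Prop. 3.7 (energy estimates for derivatives, uniform in the viscosity)] -/
theorem slot_level_one (hab : a < b) (h : Torus.IsClassicalScalarTransportForcedOn (Icc a b) κ u s θ)
    (hκ : 0 ≤ κ) (hu0 : ∀ t ∈ Icc a b, ∀ x, Torus.partialDeriv k (u t) x = 0)
    (hu1 : ∀ t ∈ Icc a b, ∀ x (w : EuclideanSpace ℝ d), |⟪Torus.partialDeriv k' (u t) x, w⟫_ℝ| ≤ α t * |w k|)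
    (hα : Continuous α) (hα0 : ∀ τ ∈ Icc a b, 0 ≤ α τ)
    {σk σk' : ℝ → ℝ} (hσk : Continuous σk) (hσk0 : ∀ τ ∈ Icc a b, 0 ≤ σk τ)
    (hσk' : Continuous σk') (hσk'0 : ∀ τ ∈ Icc a b, 0 ≤ σk' τ)
    (hsk : ∀ τ ∈ Icc a b, Real.sqrt (∫ x, (Torus.partialDeriv k (s τ) x) ^ 2) ≤ σk τ)
    (hsk' : ∀ τ ∈ Icc a b, Real.sqrt (∫ x, (Torus.partialDeriv k' (s τ) x) ^ 2) ≤ σk' τ)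
    {t : ℝ} (ht : t ∈ Icc a b) :
    Real.sqrt (∫ x, (Torus.partialDeriv k (θ t) x) ^ 2) ≤
        Real.sqrt (∫ x, (Torus.partialDeriv k (θ a) x) ^ 2) + ∫ τ in a..b, σk τ ∧
      Real.sqrt (∫ x, (Torus.partialDeriv k' (θ t) x) ^ 2) ≤
        Real.sqrt (∫ x, (Torus.partialDeriv k' (θ a) x) ^ 2) + (∫ τ in a..b, σk' τ) +
          (∫ τ in a..b, α τ) * (Real.sqrt (∫ x, (Torus.partialDeriv k (θ a) x) ^ 2) + ∫ τ in a..b, σk τ) := by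
  set Wk := Real.sqrt (∫ x, (Torus.partialDeriv k (θ a) x) ^ 2) with hWk
  have hWk0 : 0 ≤ Wk := Real.sqrt_nonneg _
  have hSk0 : 0 ≤ ∫ τ in a..b, σk τ := intervalIntegral.integral_nonneg hab.le hσk0
  -- streamwise
  have hB : ∀ τ ∈ Icc a b, Real.sqrt (∫ x, (Torus.partialDeriv k (θ τ) x) ^ 2) ≤ Wk + ∫ τ in a..b, σk τ := by
    intro τ hτ
    have h1 := stream_deriv_le hab h hκ hu0 hσk.continuousOn hσk0 hsk hτ
    have h2 := integral_le_integral_right hσk hτ hσk0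
    linarith
  refine ⟨hB t ht, ?_⟩
  -- cross-stream
  have h1 := cross_deriv_le hab h hκ hu1 hα.continuousOn hα0 hσk'.continuousOn hσk'0 hsk'
    (add_nonneg hWk0 hSk0) hB ht
  have h2 := integral_add_mul_const_le hσk' hα ht hσk'0 hα0 (add_nonneg hWk0 hSk0)
  linarith

/-- **Slot summary, level 2.** Over one half pulse `[a, b]` of a shear drift (`∂ₖu = 0`,
`|⟪∂ₖ'u, w⟫| ≤ α|wₖ|`, `|⟪∂ₖ'∂ₖ'u, w⟫| ≤ β|wₖ|`; `Γ = ∫ₐᵇ α`, `Β = ∫ₐᵇ β`), with source budgets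
`Σₖ ≥ ∫‖∂ₖs‖₂`, `Σₖₖ`, `Σₖₖ'`, `Σₖ'ₖ'`: for all `t ∈ [a, b]`,
`‖∂ₖ∂ₖθ(t)‖₂ ≤ Vₖₖ + Σₖₖ`, `‖∂ₖ∂ₖ'θ(t)‖₂ ≤ Vₖₖ' + Σₖₖ' + Γ(Vₖₖ + Σₖₖ)` and
`‖∂ₖ'∂ₖ'θ(t)‖₂ ≤ Vₖ'ₖ' + Σₖ'ₖ' + Β(Wₖ + Σₖ) + 2Γ(Vₖₖ' + Σₖₖ') + Γ²(Vₖₖ + Σₖₖ)` (`V`, `W` the values at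
`a`) — the unipotent map `(Vₖₖ, Vₖₖ', Vₖ'ₖ') ↦ (Vₖₖ, Vₖₖ' + ΓVₖₖ, Vₖ'ₖ' + 2ΓVₖₖ' + Γ²Vₖₖ)` (the `Γ²`
from `∫ₐᵗ αA = A²/2`), uniformly in `κ ≥ 0`.
[cite: MajdaBertozzi2002, §3.2 Prop. 3.7 (energy estimates for derivatives, uniform in the viscosity)] -/
theorem slot_level_two (hab : a < b) (h : Torus.IsClassicalScalarTransportForcedOn (Icc a b) κ u s θ)
    (hκ : 0 ≤ κ) (hu0 : ∀ t ∈ Icc a b, ∀ x, Torus.partialDeriv k (u t) x = 0)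
    (hu1 : ∀ t ∈ Icc a b, ∀ x (w : EuclideanSpace ℝ d), |⟪Torus.partialDeriv k' (u t) x, w⟫_ℝ| ≤ α t * |w k|)
    (hu2 : ∀ t ∈ Icc a b, ∀ x (w : EuclideanSpace ℝ d),
      |⟪Torus.partialDeriv k' (Torus.partialDeriv k' (u t)) x, w⟫_ℝ| ≤ β t * |w k|)
    (hα : Continuous α) (hα0 : ∀ τ ∈ Icc a b, 0 ≤ α τ)
    (hβ : Continuous β) (hβ0 : ∀ τ ∈ Icc a b, 0 ≤ β τ)
    {σk σkk σkk' σk'k' : ℝ → ℝ} (hσk : Continuous σk) (hσk0 : ∀ τ ∈ Icc a b, 0 ≤ σk τ)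
    (hσkk : Continuous σkk) (hσkk0 : ∀ τ ∈ Icc a b, 0 ≤ σkk τ)
    (hσkk' : Continuous σkk') (hσkk'0 : ∀ τ ∈ Icc a b, 0 ≤ σkk' τ)
    (hσk'k' : Continuous σk'k') (hσk'k'0 : ∀ τ ∈ Icc a b, 0 ≤ σk'k' τ)
    (hsk : ∀ τ ∈ Icc a b, Real.sqrt (∫ x, (Torus.partialDeriv k (s τ) x) ^ 2) ≤ σk τ)
    (hskk : ∀ τ ∈ Icc a b,
      Real.sqrt (∫ x, (Torus.partialDeriv k (Torus.partialDeriv k (s τ)) x) ^ 2) ≤ σkk τ)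
    (hskk' : ∀ τ ∈ Icc a b,
      Real.sqrt (∫ x, (Torus.partialDeriv k (Torus.partialDeriv k' (s τ)) x) ^ 2) ≤ σkk' τ)
    (hsk'k' : ∀ τ ∈ Icc a b,
      Real.sqrt (∫ x, (Torus.partialDeriv k' (Torus.partialDeriv k' (s τ)) x) ^ 2) ≤ σk'k' τ)
    {t : ℝ} (ht : t ∈ Icc a b) :
    Real.sqrt (∫ x, (Torus.partialDeriv k (Torus.partialDeriv k (θ t)) x) ^ 2) ≤
        Real.sqrt (∫ x, (Torus.partialDeriv k (Torus.partialDeriv k (θ a)) x) ^ 2) + ∫ τ in a..b, σkk τ ∧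
      Real.sqrt (∫ x, (Torus.partialDeriv k (Torus.partialDeriv k' (θ t)) x) ^ 2) ≤
        Real.sqrt (∫ x, (Torus.partialDeriv k (Torus.partialDeriv k' (θ a)) x) ^ 2) + (∫ τ in a..b, σkk' τ) +
          (∫ τ in a..b, α τ) *
            (Real.sqrt (∫ x, (Torus.partialDeriv k (Torus.partialDeriv k (θ a)) x) ^ 2) + ∫ τ in a..b, σkk τ) ∧
      Real.sqrt (∫ x, (Torus.partialDeriv k' (Torus.partialDeriv k' (θ t)) x) ^ 2) ≤
        Real.sqrt (∫ x, (Torus.partialDeriv k' (Torus.partialDeriv k' (θ a)) x) ^ 2) + (∫ τ in a..b, σk'k' τ) +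
          (∫ τ in a..b, β τ) * (Real.sqrt (∫ x, (Torus.partialDeriv k (θ a) x) ^ 2) + ∫ τ in a..b, σk τ) +
          2 * (∫ τ in a..b, α τ) *
            (Real.sqrt (∫ x, (Torus.partialDeriv k (Torus.partialDeriv k' (θ a)) x) ^ 2) + ∫ τ in a..b, σkk' τ) +
          (∫ τ in a..b, α τ) ^ 2 *
            (Real.sqrt (∫ x, (Torus.partialDeriv k (Torus.partialDeriv k (θ a)) x) ^ 2) + ∫ τ in a..b, σkk τ) := by
  set Wk := Real.sqrt (∫ x, (Torus.partialDeriv k (θ a) x) ^ 2) with hWk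
  set Vkk := Real.sqrt (∫ x, (Torus.partialDeriv k (Torus.partialDeriv k (θ a)) x) ^ 2) with hVkk
  set Vkk' := Real.sqrt (∫ x, (Torus.partialDeriv k (Torus.partialDeriv k' (θ a)) x) ^ 2) with hVkk'
  set Γ := ∫ τ in a..b, α τ with hΓ
  have hWk0 : 0 ≤ Wk := Real.sqrt_nonneg _
  have hVkk0 : 0 ≤ Vkk := Real.sqrt_nonneg _
  have hVkk'0 : 0 ≤ Vkk' := Real.sqrt_nonneg _
  have hSk0 : 0 ≤ ∫ τ in a..b, σk τ := intervalIntegral.integral_nonneg hab.le hσk0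
  have hSkk0 : 0 ≤ ∫ τ in a..b, σkk τ := intervalIntegral.integral_nonneg hab.le hσkk0
  have hSkk'0 : 0 ≤ ∫ τ in a..b, σkk' τ := intervalIntegral.integral_nonneg hab.le hσkk'0
  have hΓ0 : 0 ≤ Γ := intervalIntegral.integral_nonneg hab.le hα0
  -- level-1 streamwise bound (input of the cross–cross step)
  have hB : ∀ τ ∈ Icc a b, Real.sqrt (∫ x, (Torus.partialDeriv k (θ τ) x) ^ 2) ≤ Wk + ∫ τ in a..b, σk τ := by
    intro τ hτ
    have h1 := stream_deriv_le hab h hκ hu0 hσk.continuousOn hσk0 hsk hτ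
    have h2 := integral_le_integral_right hσk hτ hσk0
    linarith
  -- level-2 streamwise–streamwise
  have hBkk : ∀ τ ∈ Icc a b,
      Real.sqrt (∫ x, (Torus.partialDeriv k (Torus.partialDeriv k (θ τ)) x) ^ 2) ≤ Vkk + ∫ τ in a..b, σkk τ := by
    intro τ hτ
    have h1 := stream_stream_deriv_le hab h hκ hu0 hσkk.continuousOn hσkk0 hskk hτ
    have h2 := integral_le_integral_right hσkk hτ hσkk0
    linarith
  -- level-2 mixed, with the time-resolved shear factor `A(τ) = ∫ₐ^τ α`
  set M : ℝ → ℝ := fun τ => Vkk' + (∫ τ in a..b, σkk' τ) + (∫ σ in a..τ, α σ) * (Vkk + ∫ τ in a..b, σkk τ)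
    with hM
  have hMc : Continuous M :=
    (continuous_const.add continuous_const).add
      ((intervalIntegral.continuous_primitive (fun _ _ => hα.intervalIntegrable _ _) a).mul continuous_const)
  have hA0 : ∀ τ ∈ Icc a b, 0 ≤ ∫ σ in a..τ, α σ := fun τ hτ => integral_nonneg_of_mem_Icc hτ hα0
  have hAle : ∀ τ ∈ Icc a b, ∫ σ in a..τ, α σ ≤ Γ := fun τ hτ => integral_le_integral_right hα hτ hα0
  have hM0 : ∀ τ ∈ Icc a b, 0 ≤ M τ := fun τ hτ =>
    add_nonneg (add_nonneg hVkk'0 hSkk'0) (mul_nonneg (hA0 τ hτ) (add_nonneg hVkk0 hSkk0))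
  have hBkk' : ∀ τ ∈ Icc a b,
      Real.sqrt (∫ x, (Torus.partialDeriv k (Torus.partialDeriv k' (θ τ)) x) ^ 2) ≤ M τ := by
    intro τ hτ
    have h1 := stream_cross_deriv_le hab h hκ hu0 hu1 hα.continuousOn hα0 hσkk'.continuousOn hσkk'0 hskk'
      (add_nonneg hVkk0 hSkk0) hBkk hτ
    have hc : Continuous fun σ => α σ * (Vkk + ∫ τ in a..b, σkk τ) := hα.mul continuous_const
    rw [intervalIntegral.integral_add (hσkk'.intervalIntegrable a τ) (hc.intervalIntegrable a τ),
      intervalIntegral.integral_mul_const] at h1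
    have h2 := integral_le_integral_right hσkk' hτ hσkk'0
    show _ ≤ Vkk' + (∫ τ in a..b, σkk' τ) + (∫ σ in a..τ, α σ) * (Vkk + ∫ τ in a..b, σkk τ)
    linarith
  refine ⟨hBkk t ht, ?_, ?_⟩
  · have h1 := hBkk' t ht
    have h2 : (∫ σ in a..t, α σ) * (Vkk + ∫ τ in a..b, σkk τ) ≤ Γ * (Vkk + ∫ τ in a..b, σkk τ) :=
      mul_le_mul_of_nonneg_right (hAle t ht) (add_nonneg hVkk0 hSkk0)
    have e : M t = Vkk' + (∫ τ in a..b, σkk' τ) + (∫ σ in a..t, α σ) * (Vkk + ∫ τ in a..b, σkk τ) := rfl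
    linarith
  -- level-2 cross–cross
  have h1 := cross_cross_deriv_le hab h hκ hu1 hu2 hα.continuousOn hα0 hβ.continuousOn hβ0
    hσk'k'.continuousOn hσk'k'0 hsk'k' (add_nonneg hWk0 hSk0) hB hMc.continuousOn hM0 hBkk' ht
  -- evaluate `∫ₐᵗ (σ + βB + 2αM)`
  have cβ : Continuous fun τ => β τ * (Wk + ∫ τ in a..b, σk τ) := hβ.mul continuous_const
  have cαM : Continuous fun τ => 2 * (α τ * M τ) := continuous_const.mul (hα.mul hMc)
  have iσ := hσk'k'.intervalIntegrable (μ := volume) a t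
  have iβ := cβ.intervalIntegrable (μ := volume) a t
  have iαM := cαM.intervalIntegrable (μ := volume) a t
  have e1 : ∫ τ in a..t, (σk'k' τ + β τ * (Wk + ∫ τ in a..b, σk τ) + 2 * (α τ * M τ)) =
      (∫ τ in a..t, σk'k' τ) + (Wk + ∫ τ in a..b, σk τ) * (∫ τ in a..t, β τ) + 2 * ∫ τ in a..t, α τ * M τ := by
    rw [intervalIntegral.integral_add (iσ.add iβ) iαM, intervalIntegral.integral_add iσ iβ,
      intervalIntegral.integral_mul_const, intervalIntegral.integral_const_mul]
    ring
  have e2 : ∫ τ in a..t, α τ * M τ = (Vkk' + ∫ τ in a..b, σkk' τ) * (∫ τ in a..t, α τ) +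
      (Vkk + ∫ τ in a..b, σkk τ) * ∫ τ in a..t, α τ * (∫ σ in a..τ, α σ) := by
    have eM : (fun τ => α τ * M τ) = fun τ => α τ * (Vkk' + ∫ τ in a..b, σkk' τ) +
        (α τ * ∫ σ in a..τ, α σ) * (Vkk + ∫ τ in a..b, σkk τ) := by
      funext τ; simp only [hM]; ring
    have cA : Continuous fun τ => ∫ σ in a..τ, α σ :=
      intervalIntegral.continuous_primitive (fun _ _ => hα.intervalIntegrable _ _) a
    have c1 : Continuous fun τ => α τ * (Vkk' + ∫ τ in a..b, σkk' τ) := hα.mul continuous_const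
    have c2 : Continuous fun τ => (α τ * ∫ σ in a..τ, α σ) * (Vkk + ∫ τ in a..b, σkk τ) :=
      (hα.mul cA).mul continuous_const
    rw [eM, intervalIntegral.integral_add (c1.intervalIntegrable a t) (c2.intervalIntegrable a t),
      intervalIntegral.integral_mul_const, intervalIntegral.integral_mul_const]
    ring
  have i1 := integral_le_integral_right hσk'k' ht hσk'k'0
  have i2 := integral_le_integral_right hβ ht hβ0
  have i3 := hAle t ht
  have i4 := integral_mul_cumulative_le hα ht hα0
  rw [e1, e2] at h1
  have hB0' : 0 ≤ Wk + ∫ τ in a..b, σk τ := add_nonneg hWk0 hSk0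
  have hC0 : 0 ≤ Vkk' + ∫ τ in a..b, σkk' τ := add_nonneg hVkk'0 hSkk'0
  have hD0 : 0 ≤ Vkk + ∫ τ in a..b, σkk τ := add_nonneg hVkk0 hSkk0
  nlinarith [mul_le_mul_of_nonneg_left i2 hB0', mul_le_mul_of_nonneg_left i3 hC0,
    mul_le_mul_of_nonneg_left i4 hD0]

end Slot

end Summit.AnomalousDissipation.AnomalousDissipation.Theorems.SawtoothPulseCascade.LipAgmon

end
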